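import Literature.NumberTheory.Automorphic.ArtinLFunctions
import Literature.NumberTheory.GaloisRepresentations.HeckeCharacter
import HarnessLib

/-!
# Artin–Brauer meromorphy: Brauer's factorisation and the reduction to Hecke L-functions
(companion to `Literature.NumberTheory.Automorphic.ArtinLFunctions`; serves the named fact
`Literature.NumberTheory.Automorphic.artin_brauer_hasMeromorphicContinuation`, the second part of **lang.S29**)

The named fact `Literature.NumberTheory.Automorphic.artin_brauer_hasMeromorphicContinuation` (Brauer, *On Artin's
L-series with general group characters*, Ann. of Math. 48 (1947); Neukirch, *Algebraic Number
Theory*, VII (12.6)) says that the Artin L-function `L(s, ρ)` of an Artin representation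
`ρ : Γ_K → GL(V)` extends meromorphically to `ℂ`.  The printed proof (Brauer 1947; Neukirch,
VII §10 and proof of (12.6), p. 537) has exactly three inputs, none of which has a Lean
substrate at this pin (no Brauer induction theorem, no class field theory, no Tate thesis in
Mathlib), so the fact is decomposed here into named facts mirroring those inputs, and the
deduction itself is **proved**:

* `brauer_artinLFunction_eq_prod_zpow` (**named fact**; Brauer 1947, via Brauer's induction
  theorem, Neukirch VII (10.3), and the Artin formalism (10.4) (ii), (iv)):
  `L(s, ρ) = ∏ᵢ L(s, ψᵢ)^{nᵢ}` on `re s > 1` with `nᵢ ∈ ℤ` and `ψᵢ` characters of degree `1`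
  of the absolute Galois groups of finite extensions `Kᵢ ⊇ K`;
* `artinLFunction_abelian_eq_heckeLFunction` (**named fact**; Artin reciprocity in the form
  Neukirch VII (10.6) with the Remark following it, and the dictionary (6.14) between
  Größencharaktere and characters of the idele class group): the Artin L-function of a
  character of degree `1` of `Γ_K` is the Hecke L-function `heckeLFunction χ` of a finite-order
  Hecke character `χ` of `K` (`Literature.NumberTheory.GaloisRepresentations.HeckeCharacter`);
* `Literature.heckeLFunction_hasMeromorphicContinuation χ` (**named fact**, already in the tree;
  Hecke 1920, Tate 1950 Thm. 4.4.1, Neukirch VII (8.5)–(8.6)).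

`artin_brauer_hasMeromorphicContinuation_of_brauer` (**proved**) deduces the fact from these
three: with `gᵢ` a meromorphic continuation of `L(s, χᵢ)`, the function `∏ᵢ gᵢ^{nᵢ}` is
meromorphic on `ℂ` (Mathlib `MeromorphicAt.fun_prod`, `MeromorphicAt.zpow`) and agrees with
`L(s, ρ)` on `re s > 1`.  The unconditional discharge
`artin_brauer_hasMeromorphicContinuation_holds` therefore waits for the three inputs
(recorded as the plan of the fact's literature-prover folder).

## Mathlib / tree search

Mathlib (this pin) has `Meromorphic` with `prod`/`zpow` closure
(`Analysis/Meromorphic/Basic.lean`), `Representation.character`, `Representation.ind`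
(`RepresentationTheory/Induced.lean`), but no Brauer induction theorem (grep `Brauer`: only
Brauer groups), no Artin reciprocity / global class field theory, no analytic continuation of
Hecke or Dedekind L-functions beyond `riemannZeta` and Dirichlet L-functions.  The tree has
`ArtinRep`, `artinLFunction`, `FramedArtinRep`, `LFunction.HasMeromorphicContinuation`
(`Literature.NumberTheory.GaloisRepresentations.ArtinLFunction`), `HeckeCharacter`,
`heckeLFunction`, `HeckeCharacter.IsFiniteOrder` (with the proved
`IsFiniteOrder.isUnitary`) and the named fact `heckeLFunction_hasMeromorphicContinuation`
(`Literature.NumberTheory.GaloisRepresentations.HeckeCharacter`).  Nothing here duplicates an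
existing declaration.

## Design choices

* The intermediate fields `Kᵢ` of Brauer's factorisation are rendered as number fields
  `M i : Type u` equipped with `[Algebra K (M i)]` (finite extensions of `K`, up to
  `K`-isomorphism), and the degree-one characters `ψᵢ` of `G(L|Kᵢ)` as rank-one framed Artin
  representations `FramedArtinRep (M i) 1` of `Γ_{Kᵢ}` (their inflations; the Artin
  L-function is inflation invariant, Neukirch VII (10.4) (iii), and `artinLFunction` is defined
  on the absolute Galois group with inertia invariants, so no choice of `L` is needed).
* Integral powers are Lean's `zpow` on `ℂ`; the printed identity divides by abelian
  L-functions, which do not vanish on `re s > 1` (convergent Euler products), so the pointwise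
  identity on `re s > 1` is exactly what is printed.
* The Hecke side of `artinLFunction_abelian_eq_heckeLFunction` is an `∃ χ` over finite-order
  Hecke characters: this is insensitive to the normalisation of the reciprocity map
  (`χ ↦ χ⁻¹` preserves finite order) and to the arithmetic-Frobenius convention of
  `ArtinRep.eulerFactorAt` (OUTLINE §1), both of which Neukirch fixes as we do
  (`φ_𝔓 = ` arithmetic Frobenius, `c(𝔭) = ⟨π_𝔭⟩`, VII (6.14)).

## References

* R. Brauer, *On Artin's L-series with general group characters*, Ann. of Math. (2) 48
  (1947), 502–514 (`Brauer1947`).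
* J. Neukirch, *Algebraic Number Theory*, Grundlehren 322 (1999), Ch. VII: (6.14), (8.5)–(8.6)
  (Hecke L-series), (10.3) (Brauer's theorem), (10.4) (Artin formalism), (10.6) and the Remark
  following it (abelian Artin L-series are Hecke L-series), (12.6) and its proof, p. 537
  (`NeukirchANT1999`).
* J.-P. Serre, *Linear Representations of Finite Groups*, GTM 42 (1977), §10.5, Thm. 19–20
  and Remark (2) ("it is by this method that Brauer proved the Artin L-functions are
  meromorphic") (`SerreLinearRepresentations1977`).
* J. Tate, *Fourier analysis in number fields and Hecke's zeta-functions* (1950), in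
  Cassels–Fröhlich (1967), Thm. 4.4.1 (`TateThesis1967`).
-/

noncomputable section

open scoped NumberField
open IsDedekindDomain NumberField

namespace Literature.NumberTheory.Automorphic

section Lang

universe u w

section Brauer

variable {K : Type u} [Field K] [NumberField K] {V : Type w} [AddCommGroup V] [Module ℂ V]
  [TopologicalSpace V] [FiniteDimensional ℂ V]

/-- **Brauer's factorisation of Artin L-functions** (Brauer, Ann. of Math. 48 (1947), main
theorem: an Artin L-series with a general group character is a product of integral powers of
abelian L-series of intermediate fields, obtained from Brauer's induction theorem; Neukirch,
*Algebraic Number Theory*, VII (10.3) with (10.4) (ii), (iv), as used in the proof of (12.6):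
`𝓛(L|K, χ, s) = ∏ᵢ 𝓛(L|Kᵢ, χᵢ, s)^{nᵢ}`, `nᵢ ∈ ℤ`, `χᵢ` characters of degree `1` of
`Hᵢ = G(L|Kᵢ)`; Serre, *Linear Representations*, §10.5, Thm. 20 and Remark (2)).  For every Artin representation `ρ` of the number
field `K` on a finite-dimensional `V` (module topology, OUTLINE D1) there are finitely many
finite extensions `Kᵢ ⊇ K` (number fields `M i` with `[Algebra K (M i)]`), characters of
degree one `ψᵢ : Γ_{Kᵢ} → GL_1(ℂ)` (`FramedArtinRep (M i) 1`) and integers `nᵢ` such that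
`L(s, ρ) = ∏ᵢ L(s, ψᵢ)^{nᵢ}` for `re s > 1` (`artinLFunction`, integral powers `zpow`).
[cite: Brauer1947] [cite: NeukirchANT1999, VII (10.3), (10.4) and proof of (12.6)]
[cite: SerreLinearRepresentations1977, §10.5 Thm. 20 and Remark (2)] -/
def brauer_artinLFunction_eq_prod_zpow : Prop :=
  ∀ [IsModuleTopology ℂ V] (ρ : GaloisRepresentations.ArtinRep K V),
    ∃ (ι : Type) (_ : Fintype ι) (M : ι → Type u) (_ : ∀ i, Field (M i))
      (_ : ∀ i, NumberField (M i)) (_ : ∀ i, Algebra K (M i)) (ψ : ∀ i, GaloisRepresentations.FramedArtinRep (M i) 1)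
      (n : ι → ℤ),
      ∀ s : ℂ, 1 < s.re →
        GaloisRepresentations.artinLFunction ρ s = ∏ i, GaloisRepresentations.artinLFunction (ψ i).toArtinRep s ^ n i

/-- **Abelian Artin L-functions are Hecke L-functions** (Artin reciprocity; Neukirch,
*Algebraic Number Theory*, VII (10.6) and the Remark following it: for an *injective* character
`χ : G(L|K) → ℂˣ` one has `𝓛(L|K, χ, s) = L(χ̃, s)` with `χ̃` the (primitive) Größencharakter
`mod 𝔣(L|K)` attached to `χ` by the Artin symbol, a Dirichlet character of finite order
(VII (6.9)); VII (6.14): Größencharaktere `mod 𝔪` are the characters of the idele class group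
with module of definition `𝔪`, `χ̃(𝔭) = χ(⟨π_𝔭⟩)`).  For every character of degree one
`ψ : Γ_K → GL_1(ℂ)` of the absolute Galois group of a number field `K` (a rank-one framed
Artin representation; it is the inflation of an injective character of `G(L_ψ|K)`, `L_ψ` the
fixed field of its kernel, and `L(s, ψ) = 𝓛(L_ψ|K, ψ, s)` by VII (10.4) (iii)) there is a
Hecke character `χ` of `K` of finite order (`HeckeCharacter.IsFiniteOrder`) whose Hecke
L-function `∏_{v ∤ 𝔣(χ)} (1 - χ(ϖ_v) N v^{-s})⁻¹` (`heckeLFunction`) agrees with the Artin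
L-function of `ψ` on `re s > 1`.
[cite: NeukirchANT1999, VII (10.6) with Remark, and (6.14)] [cite: ArtinHamburg1931, §1] -/
def artinLFunction_abelian_eq_heckeLFunction : Prop :=
  ∀ ψ : GaloisRepresentations.FramedArtinRep K 1, ∃ χ : GaloisRepresentations.HeckeCharacter K, χ.IsFiniteOrder ∧
    ∀ s : ℂ, 1 < s.re → GaloisRepresentations.artinLFunction ψ.toArtinRep s = GaloisRepresentations.heckeLFunction χ s

/-- **Artin–Brauer meromorphy, the deduction** (Brauer 1947; Neukirch, *Algebraic Number
Theory*, VII, proof of (12.6): "`Λ(L|K, χ, s) = ∏ᵢ Λ(χ̃ᵢ, s)^{nᵢ}` … by (8.6) the Hecke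
L-series admit meromorphic continuations").  Granting Brauer's factorisation
`brauer_artinLFunction_eq_prod_zpow` for `ρ`'s base field and space, the identification
`artinLFunction_abelian_eq_heckeLFunction` of degree-one Artin L-functions with Hecke
L-functions over every number field (in the universe of `K`), and the meromorphic continuation
of Hecke L-functions of unitary Hecke characters (`heckeLFunction_hasMeromorphicContinuation`,
Tate 1950, Thm. 4.4.1), the Artin L-function of every Artin representation `ρ : Γ_K → GL(V)`
has meromorphic continuation: `∏ᵢ gᵢ^{nᵢ}` is meromorphic on `ℂ` for meromorphic `gᵢ`
(Mathlib `MeromorphicAt.fun_prod`, `MeromorphicAt.zpow`) and agrees with `L(s, ρ)` on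
`re s > 1`.  Finite-order Hecke characters are unitary (`HeckeCharacter.IsFiniteOrder.isUnitary`).
[cite: NeukirchANT1999, VII proof of (12.6)] [cite: Brauer1947] -/
theorem artin_brauer_hasMeromorphicContinuation_of_brauer
    (hA : brauer_artinLFunction_eq_prod_zpow (K := K) (V := V))
    (hB : ∀ (M : Type u) [Field M] [NumberField M],
      artinLFunction_abelian_eq_heckeLFunction (K := M))
    (hC : ∀ (M : Type u) [Field M] [NumberField M] (χ : GaloisRepresentations.HeckeCharacter M),
      GaloisRepresentations.heckeLFunction_hasMeromorphicContinuation χ) :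
    artin_brauer_hasMeromorphicContinuation (K := K) (V := V) := by
  intro _ ρ
  obtain ⟨ι, _, M, _, _, _, ψ, n, hL⟩ := hA ρ
  choose χ hχ hχL using fun i => hB (M i) (ψ i)
  choose g hg hgL using fun i => hC (M i) (χ i) (hχ i).isUnitary
  refine ⟨fun s => ∏ i, g i s ^ n i, fun x => ?_, fun s hs => ?_⟩
  · exact MeromorphicAt.fun_prod (F := fun i z => g i z ^ n i) fun i _ => (hg i x).fun_zpow (n i)
  · rw [hL s hs]
    exact Finset.prod_congr rfl fun i _ => by rw [hgL i s hs, hχL i s hs]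

end Brauer

end Lang

end Literature.NumberTheory.Automorphic
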